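import Summits.FinalStateConjecture.FinalStateConjecture.Theorems.SwallowTheDatumKerrShieldedDataExistCapFarAlgebra
import Summits.FinalStateConjecture.FinalStateConjecture.Theorems.SwallowTheDatumKerrShieldedDataExistCapFarMetric
import Literature.Geometry.Lorentzian.KerrIngoingCoordPullback
import Literature.Geometry.Lorentzian.DecaySymbolsSqrt
import HarnessLib

/-!
# `KerrShieldedDataExist`, line `plug-the-second-sheet` (skeleton v4 "KerrCap") — stub `stub_capFarH`:
# the far zone of the cap is a Dafermos–Rodnianski end, metric half

Support file (`--supports stmt-FinalStateConjecture-10055`; everything proved, no definitions, no named facts):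
the registered stub `stub_capFarH` of `Cruxes/KerrShieldedDataExist/Lines/plug_the_second_sheet.lean`, proved
verbatim. On the far zone `s = ‖u‖ > σ₅` the induced metric of the cap map is, in closed form
(`KerrCap.bilin_fderiv_capFar`, `KerrCap.inducedBilin_capFar` below, assembled from the Kerr–Schild data and
profile derivatives of `…CapFarMetric.lean` and the scalar identities of `…CapFarAlgebra.lean`),
`h_u(v, w) = (Σ/s²)⟪v, w⟫ + a²(r² + 2Mr + a²μ²)/(Σs⁴)(u₀v₁ − u₁v₀)(u₀w₁ − u₁w₀)`, `r = s + M + (M² − a²)/4s`,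
`μ = u₂/s`, `Σ = r² + a²μ²`. Here:

* `KerrCap.isBigOSmooth_capFarH` — **the decay**: `h_u(v, w) − (1 + 2M/s)⟪v, w⟫ ∈ O_k(s⁻²)` for every `k`, by the
  symbol calculus of `DecaySymbols*.lean`: `Σ/s² − 1 − 2M/s = (M² + 2c₀)s⁻² + 2Mc₀s⁻³ + (c₀² + a²u₂²)s⁻⁴`
  (`c₀ = (M² − a²)/4`; `s⁻ⁿ ∈ O_k(−n)`, `u₂ ∈ O_k(1)`), and the second coefficient is
  `a² · N · (Σ/s²)⁻¹ · s⁻⁴` with `N, Σ/s² ∈ O_k(0)`, `Σ/s² → 1` (`IsBigOSmooth.inv`), times the product of the two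
  linear symbols `u₀v₁ − u₁v₀`, `u₀w₁ − u₁w₀ ∈ O_k(1)`;
* `cap_farMetric` — registered export of the closed form;
* **`stub_capFarH`**: a total field `hTot` agreeing with the induced metric beyond `σ₅` has
  `hTot − (1 + 2M/s)δ ∈ O₂(s⁻²)` (componentwise on the standard basis, `IsBigOSmooth.of_bilinForm_apply`, and
  locality `IsBigOSmooth.congr_far`).

References: Brandt–Seidel, PRD 54 (1996) 1403, §II; Bartnik, CPAM 39 (1986), Def. 2.1; Dafermos–Rodnianski
arXiv:0811.0354, App. B.2.3.
-/

-- the doubled `FinalStateConjecture` path component is the summit/problem naming scheme, not a mistake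
set_option linter.dupNamespace false

noncomputable section

open Set Function Filter Topology TopologicalSpace Bornology
open scoped Manifold ContDiff Topology InnerProductSpace
open Literature.Geometry.Lorentzian
open Summit.FinalStateConjecture.FinalStateConjecture.Theorems.KerrShieldedDataExist

namespace Summit.FinalStateConjecture.FinalStateConjecture.Theorems.SwallowTheDatum

namespace KerrCap

/-! ### The closed form of the induced metric on the far zone -/

section Far

variable {M a c σ₅ : ℝ} {τ ϱ α : ℝ → ℝ} {X : E3 → E3}

/-- **The induced metric of the cap map on the far zone, closed form.** For `‖u‖ = s > σ₅` (far-zone profiles as in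
`stub_capFarH`) and all `v, w`,
`g_{Φ u}(DΦ(u)v, DΦ(u)w) = (Σ/s²)⟪v, w⟫ + a²(r² + 2Mr + a²μ²)/(Σs⁴) (u₀v₁ − u₁v₀)(u₀w₁ − u₁w₀)`, `r = ϱ(s)`,
`μ = u₂/s`, `Σ = r² + a²μ²`: expand `g = η + 2Hℓ ⊗ ℓ` on `DΦ v = (τ′⟪u,v⟫/s, DX v)` (`fderiv_capImm_apply`,
`fderiv_capMap_apply`, `nullCovector_capImm`, `scalarH_capImm`) and apply the scalar identities
`capFar_flat`, `capFar_ell`, `capFar_atoms` with `ϱ′, τ′, α′` from `deriv_far_rho/tau/alpha`. This is the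
Boyer–Lindquist slice metric of Kerr in quasi-isotropic Cartesian coordinates. [cite: BrandtSeidel1996, §II] -/
theorem bilin_fderiv_capFar (ha : |a| < M) (hσ₅ : 0 < σ₅)
    (hτ : ContDiff ℝ ∞ τ) (hϱ : ContDiff ℝ ∞ ϱ) (hα : ContDiff ℝ ∞ α)
    (hfar : ∀ s, σ₅ ≤ s → τ s = Negative.bentHeight M a (ϱ s) + c ∧
      ϱ s = s + M + (M ^ 2 - a ^ 2) / (4 * s) ∧
      α s = a / (Kerr.rPlus M a - Kerr.rMinus M a) *
        Real.log ((ϱ s - Kerr.rPlus M a) / (ϱ s - Kerr.rMinus M a)))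
    (h8 : ∀ s, σ₅ ≤ s → 8 * M < ϱ s)
    (hX : ∀ u : E3, X u =
      !₂[(ϱ ‖u‖ * (Real.cos (α ‖u‖) * u 0 - Real.sin (α ‖u‖) * u 1) -
            a * (Real.sin (α ‖u‖) * u 0 + Real.cos (α ‖u‖) * u 1)) / ‖u‖,
         (ϱ ‖u‖ * (Real.sin (α ‖u‖) * u 0 + Real.cos (α ‖u‖) * u 1) +
            a * (Real.cos (α ‖u‖) * u 0 - Real.sin (α ‖u‖) * u 1)) / ‖u‖,
         ϱ ‖u‖ * u 2 / ‖u‖])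
    {u : E3} (hu : σ₅ < ‖u‖) (t : ℝ) (v w : E3) :
    Kerr.bilin M a (E4.ofTimeSpace t (X u))
        (fderiv ℝ (fun u : E3 ↦ E4.ofTimeSpace (τ ‖u‖) (X u)) u v)
        (fderiv ℝ (fun u : E3 ↦ E4.ofTimeSpace (τ ‖u‖) (X u)) u w) =
      (ϱ ‖u‖ ^ 2 * ‖u‖ ^ 2 + a ^ 2 * u 2 ^ 2) / ‖u‖ ^ 4 * ⟪v, w⟫_ℝ +
        a ^ 2 * (ϱ ‖u‖ ^ 2 * ‖u‖ ^ 2 + 2 * M * ϱ ‖u‖ * ‖u‖ ^ 2 + a ^ 2 * u 2 ^ 2) /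
            ((ϱ ‖u‖ ^ 2 * ‖u‖ ^ 2 + a ^ 2 * u 2 ^ 2) * ‖u‖ ^ 4) *
          ((u 0 * v 1 - u 1 * v 0) * (u 0 * w 1 - u 1 * w 0)) := by
  have hs0 : 0 < ‖u‖ := hσ₅.trans hu
  have hs : ‖u‖ ≠ 0 := hs0.ne'
  have hu0 : u ≠ 0 := norm_ne_zero_iff.1 hs
  have hM := Negative.mass_pos ha
  obtain ⟨hτs, hϱs, hαs⟩ := hfar ‖u‖ hu.le
  have hrp : Kerr.rPlus M a < ϱ ‖u‖ := rPlus_lt_far ha h8 hu.le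
  have hr0 : 0 < ϱ ‖u‖ := by linarith [h8 ‖u‖ hu.le]
  have hΔ : ϱ ‖u‖ ^ 2 - 2 * M * ϱ ‖u‖ + a ^ 2 ≠ 0 := (Negative.delta_pos ha hrp).ne'
  have hS : ϱ ‖u‖ ^ 2 * ‖u‖ ^ 2 + a ^ 2 * u 2 ^ 2 ≠ 0 := by positivity
  -- the far-zone derivatives at `s = ‖u‖`
  have hdϱ : deriv ϱ ‖u‖ = 1 - (M ^ 2 - a ^ 2) / (4 * ‖u‖ ^ 2) :=
    deriv_far_rho hσ₅ (fun s hs' ↦ (hfar s hs').2.1) hu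
  have hdτ : deriv τ ‖u‖ = 2 * M * ϱ ‖u‖ / (ϱ ‖u‖ ^ 2 - 2 * M * ϱ ‖u‖ + a ^ 2) * deriv ϱ ‖u‖ :=
    deriv_far_tau ha hϱ (fun s hs' ↦ (hfar s hs').1) (h8 ‖u‖ hu.le).le hu
  have hdα : deriv α ‖u‖ = a / (ϱ ‖u‖ ^ 2 - 2 * M * ϱ ‖u‖ + a ^ 2) * deriv ϱ ‖u‖ :=
    deriv_far_alpha ha hϱ (fun s hs' ↦ (hfar s hs').2.2) hrp hu
  -- expand `g = η + 2Hℓ ⊗ ℓ` on `DΦ v = (τ′⟪u,v⟫/s, DX v)`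
  rw [fderiv_capImm_apply hX hτ hϱ hα hu0 v, fderiv_capImm_apply hX hτ hϱ hα hu0 w, Kerr.bilin_apply,
    Kerr.minkowski_bilin_eq_spatial, nullCovector_capImm hX hu0 hr0, nullCovector_capImm hX hu0 hr0,
    scalarH_capImm hX hu0 hr0]
  simp only [E4.ofTimeSpace_apply_zero, E4.spatial_ofTimeSpace]
  rw [Kerr.Ingoing.inner_e3 (fderiv ℝ X u v) (fderiv ℝ X u w)]
  -- the components of `DX`
  obtain ⟨h0v, h1v, h2v⟩ := fderiv_capMap_apply hX hϱ hα hu0 v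
  obtain ⟨h0w, h1w, h2w⟩ := fderiv_capMap_apply hX hϱ hα hu0 w
  have hcs := Real.sin_sq_add_cos_sq (α ‖u‖)
  have huv := Kerr.Ingoing.inner_e3 u v
  have huw := Kerr.Ingoing.inner_e3 u w
  have hvw := Kerr.Ingoing.inner_e3 v w
  have hn := E3.norm_sq u
  -- the scalar identities
  have hℓv := capFar_ell (ωv := u 0 * v 1 - u 1 * v 0) hs h0v h1v h2v
    (by rw [huv]; linear_combination (u 0 * v 0 + u 1 * v 1) * hcs)
    (by linear_combination (u 0 * v 1 - u 1 * v 0) * hcs)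
    (by rw [hn]; linear_combination (u 0 ^ 2 + u 1 ^ 2) * hcs)
  have hℓw := capFar_ell (ωv := u 0 * w 1 - u 1 * w 0) hs h0w h1w h2w
    (by rw [huw]; linear_combination (u 0 * w 0 + u 1 * w 1) * hcs)
    (by linear_combination (u 0 * w 1 - u 1 * w 0) * hcs)
    (by rw [hn]; linear_combination (u 0 ^ 2 + u 1 ^ 2) * hcs)
  have hflat := capFar_flat (ivw := ⟪v, w⟫_ℝ) (ωv := u 0 * v 1 - u 1 * v 0) (ωw := u 0 * w 1 - u 1 * w 0)
    hs h0v h1v h2v h0w h1w h2w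
    (by rw [huv]; linear_combination (u 0 * v 0 + u 1 * v 1) * hcs)
    (by rw [huw]; linear_combination (u 0 * w 0 + u 1 * w 1) * hcs)
    (by rw [hvw]; linear_combination (v 0 * w 0 + v 1 * w 1) * hcs)
    (by linear_combination (u 0 * v 1 - u 1 * v 0) * hcs)
    (by linear_combination (u 0 * w 1 - u 1 * w 0) * hcs)
    (by rw [hn]; linear_combination (u 0 ^ 2 + u 1 ^ 2) * hcs)
  have h2 := capFar_atoms (iv := ⟪u, v⟫_ℝ) (iw := ⟪u, w⟫_ℝ) (ivw := ⟪v, w⟫_ℝ) (ωv := u 0 * v 1 - u 1 * v 0)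
    (ωw := u 0 * w 1 - u 1 * w 0) (u2 := u 2) (v2 := v 2) (w2 := w 2) hs hϱs hdϱ hdτ hdα hΔ hS
    (by rw [huv, huw, hvw, hn]; ring)
  rw [hflat, hℓv, hℓw]
  linear_combination h2

/-- **The induced bilinear form of the cap map `Ψ : Ω → Kerr.region a r_c` on the far zone** (`u ∈ Ω`,
`‖u‖ > σ₅ > 0`): `(Ψ^* g)_u(v, w) = (Σ/s²)⟪v, w⟫ + a²(r² + 2Mr + a²μ²)/(Σs⁴)(u₀v₁ − u₁v₀)(u₀w₁ − u₁w₀)`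
(`inducedBilin` is `g(dΨ v, dΨ w)`, `dΨ = DΦ` by `OpensChart.mfderiv_apply_of_repr`, and `bilin_fderiv_capFar`).
[cite: BrandtSeidel1996, §II] -/
theorem inducedBilin_capFar [Kerr.Facts] {rc : ℝ} {Ω : Opens E3} {Ψ : Ω → Kerr.region a rc} (ha : |a| < M)
    (hσ₅ : 0 < σ₅) (hτ : ContDiff ℝ ∞ τ) (hϱ : ContDiff ℝ ∞ ϱ) (hα : ContDiff ℝ ∞ α)
    (hfar : ∀ s, σ₅ ≤ s → τ s = Negative.bentHeight M a (ϱ s) + c ∧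
      ϱ s = s + M + (M ^ 2 - a ^ 2) / (4 * s) ∧
      α s = a / (Kerr.rPlus M a - Kerr.rMinus M a) *
        Real.log ((ϱ s - Kerr.rPlus M a) / (ϱ s - Kerr.rMinus M a)))
    (h8 : ∀ s, σ₅ ≤ s → 8 * M < ϱ s)
    (hX : ∀ u : E3, X u =
      !₂[(ϱ ‖u‖ * (Real.cos (α ‖u‖) * u 0 - Real.sin (α ‖u‖) * u 1) -
            a * (Real.sin (α ‖u‖) * u 0 + Real.cos (α ‖u‖) * u 1)) / ‖u‖,
         (ϱ ‖u‖ * (Real.sin (α ‖u‖) * u 0 + Real.cos (α ‖u‖) * u 1) +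
            a * (Real.cos (α ‖u‖) * u 0 - Real.sin (α ‖u‖) * u 1)) / ‖u‖,
         ϱ ‖u‖ * u 2 / ‖u‖])
    (hΨ : ∀ u : Ω, (Ψ u : E4) = E4.ofTimeSpace (τ ‖(u : E3)‖) (X u))
    (u : Ω) (hu : σ₅ < ‖(u : E3)‖) (v w : E3) :
    (Kerr.smoothMetric M a rc).inducedBilin 𝓘(ℝ, E3) Ψ u v w =
      (ϱ ‖(u : E3)‖ ^ 2 * ‖(u : E3)‖ ^ 2 + a ^ 2 * (u : E3) 2 ^ 2) / ‖(u : E3)‖ ^ 4 * ⟪v, w⟫_ℝ +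
        a ^ 2 * (ϱ ‖(u : E3)‖ ^ 2 * ‖(u : E3)‖ ^ 2 + 2 * M * ϱ ‖(u : E3)‖ * ‖(u : E3)‖ ^ 2 +
              a ^ 2 * (u : E3) 2 ^ 2) /
            ((ϱ ‖(u : E3)‖ ^ 2 * ‖(u : E3)‖ ^ 2 + a ^ 2 * (u : E3) 2 ^ 2) * ‖(u : E3)‖ ^ 4) *
          (((u : E3) 0 * v 1 - (u : E3) 1 * v 0) * ((u : E3) 0 * w 1 - (u : E3) 1 * w 0)) := by
  have hu0 : (u : E3) ≠ 0 := norm_ne_zero_iff.1 (hσ₅.trans hu).ne'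
  have hd : DifferentiableAt ℝ (fun u : E3 ↦ E4.ofTimeSpace (τ ‖u‖) (X u)) (u : E3) :=
    differentiableAt_capImm hX hτ hϱ hα hu0
  rw [PseudoRiemannianMetric.inducedBilin_apply, Kerr.smoothMetric_val,
    OpensChart.mfderiv_apply_of_repr hΨ hd v, OpensChart.mfderiv_apply_of_repr hΨ hd w]
  have hpt : (Ψ u).1 = E4.ofTimeSpace (τ ‖(u : E3)‖) (X u) := hΨ u
  rw [hpt]
  exact bilin_fderiv_capFar ha hσ₅ hτ hϱ hα hfar h8 hX hu _ v w

end Far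



/-- **Decay of the far-zone metric of the cap**: for `ϱ(s) = s + M + (M² − a²)/4s > 0` on `s ≥ σ₅ > 0` and all
fixed `v, w`, the function
`y ↦ (Σ/s²)⟪v, w⟫ + a²(r² + 2Mr + a²μ²)/(Σs⁴)(y₀v₁ − y₁v₀)(y₀w₁ − y₁w₀) − (1 + 2M/s)⟪v, w⟫` (`s = ‖y‖`,
`r = ϱ(s)`, `μ = y₂/s`, `Σ = r² + a²μ²`) is a smooth symbol of order `−2` to every order:
`Σ/s² − 1 − 2M/s = (M² + 2c₀)s⁻² + 2Mc₀s⁻³ + (c₀² + a²y₂²)s⁻⁴`, `c₀ = (M² − a²)/4`, and the second coefficient is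
`a² N (Σ/s²)⁻¹ s⁻⁴` with `N = (r/s)² + 2M(r/s)/s + a²y₂²/s⁴`, `Σ/s² = (r/s)² + a²y₂²/s⁴ → 1` symbols of order `0`
(`r/s = 1 + M/s + c₀/s²`). Bartnik 1986, Def. 2.1 (weighted decay); the symbol calculus of
`DecaySymbols*.lean`. [cite: Bartnik1986, Def. 2.1] -/
theorem isBigOSmooth_capFarH {ϱ : ℝ → ℝ} {M a σ₅ : ℝ} (hσ₅ : 0 < σ₅)
    (hfar : ∀ s, σ₅ ≤ s → ϱ s = s + M + (M ^ 2 - a ^ 2) / (4 * s)) (hpos : ∀ s, σ₅ ≤ s → 0 < ϱ s)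
    (k : ℕ) (v w : E3) :
    IsBigOSmooth k (-2) fun y : E3 ↦
      (ϱ ‖y‖ ^ 2 * ‖y‖ ^ 2 + a ^ 2 * y 2 ^ 2) / ‖y‖ ^ 4 * ⟪v, w⟫_ℝ +
        a ^ 2 * (ϱ ‖y‖ ^ 2 * ‖y‖ ^ 2 + 2 * M * ϱ ‖y‖ * ‖y‖ ^ 2 + a ^ 2 * y 2 ^ 2) /
            ((ϱ ‖y‖ ^ 2 * ‖y‖ ^ 2 + a ^ 2 * y 2 ^ 2) * ‖y‖ ^ 4) *
          ((y 0 * v 1 - y 1 * v 0) * (y 0 * w 1 - y 1 * w 0)) -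
        (1 + 2 * M / ‖y‖) * ⟪v, w⟫_ℝ := by
  -- the atoms of the symbol calculus
  have hn1 : IsBigOSmooth k (-1) fun y : E3 ↦ ‖y‖⁻¹ := isBigOSmooth_inv_norm_all k
  have hn2 : IsBigOSmooth k (-2) fun y : E3 ↦ ‖y‖⁻¹ ^ 2 := by
    simpa using isBigOSmooth_inv_norm_pow (E' := E3) k 2
  have hn3 : IsBigOSmooth k (-3) fun y : E3 ↦ ‖y‖⁻¹ ^ 3 := by
    simpa using isBigOSmooth_inv_norm_pow (E' := E3) k 3
  have hn4 : IsBigOSmooth k (-4) fun y : E3 ↦ ‖y‖⁻¹ ^ 4 := by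
    simpa using isBigOSmooth_inv_norm_pow (E' := E3) k 4
  have hy : ∀ i : Fin 3, IsBigOSmooth k 1 fun y : E3 ↦ y i := fun i ↦
    (isBigOSmooth_clm_apply (EuclideanSpace.proj i : E3 →L[ℝ] ℝ) k).congr fun y ↦ by simp
  have hc : ∀ c : ℝ, IsBigOSmooth k 0 fun _ : E3 ↦ c := fun c ↦ isBigOSmooth_const k c
  -- `a² y₂² s⁻⁴ ∈ O_k(−2)`
  have hq : IsBigOSmooth k (-2) fun y : E3 ↦ a ^ 2 * (y 2 * y 2 * ‖y‖⁻¹ ^ 4) := by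
    have h := (((hy 2).mul (hy 2)).mul hn4).const_mul (a ^ 2)
    rwa [show (1 : ℝ) + 1 + -4 = -2 by norm_num] at h
  -- the first coefficient minus `1 + 2M/s`
  have hA : IsBigOSmooth k (-2) fun y : E3 ↦
      (M ^ 2 + 2 * ((M ^ 2 - a ^ 2) / 4)) * ‖y‖⁻¹ ^ 2 + 2 * M * ((M ^ 2 - a ^ 2) / 4) * ‖y‖⁻¹ ^ 3 +
        ((M ^ 2 - a ^ 2) / 4) ^ 2 * ‖y‖⁻¹ ^ 4 + a ^ 2 * (y 2 * y 2 * ‖y‖⁻¹ ^ 4) :=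
    (((hn2.const_mul _).add ((hn3.const_mul _).mono (by norm_num))).add
      ((hn4.const_mul _).mono (by norm_num))).add hq
  -- `r/s = 1 + M/s + c₀/s²` and the second coefficient
  have hg₀ : IsBigOSmooth k (-1) fun y : E3 ↦ M * ‖y‖⁻¹ + (M ^ 2 - a ^ 2) / 4 * ‖y‖⁻¹ ^ 2 :=
    (hn1.const_mul M).add ((hn2.const_mul _).mono (by norm_num))
  have hf₀ : IsBigOSmooth k 0 fun y : E3 ↦ 1 + (M * ‖y‖⁻¹ + (M ^ 2 - a ^ 2) / 4 * ‖y‖⁻¹ ^ 2) :=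
    (hc 1).add (hg₀.mono (by norm_num))
  have hN : IsBigOSmooth k 0 fun y : E3 ↦
      (1 + (M * ‖y‖⁻¹ + (M ^ 2 - a ^ 2) / 4 * ‖y‖⁻¹ ^ 2)) ^ 2 +
        2 * M * ‖y‖⁻¹ * (1 + (M * ‖y‖⁻¹ + (M ^ 2 - a ^ 2) / 4 * ‖y‖⁻¹ ^ 2)) +
        a ^ 2 * (y 2 * y 2 * ‖y‖⁻¹ ^ 4) := by
    have h1 := (hn1.const_mul (2 * M)).mul hf₀
    rw [show (-1 : ℝ) + 0 = -1 by norm_num] at h1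
    exact ((hf₀.pow 2).add (h1.mono (by norm_num))).add (hq.mono (by norm_num))
  have hF : IsBigOSmooth k 0 fun y : E3 ↦
      (1 + (M * ‖y‖⁻¹ + (M ^ 2 - a ^ 2) / 4 * ‖y‖⁻¹ ^ 2)) ^ 2 + a ^ 2 * (y 2 * y 2 * ‖y‖⁻¹ ^ 4) :=
    (hf₀.pow 2).add (hq.mono (by norm_num))
  have hG : IsBigOSmooth k (-1) fun y : E3 ↦
      (M * ‖y‖⁻¹ + (M ^ 2 - a ^ 2) / 4 * ‖y‖⁻¹ ^ 2) *
          (1 + (M * ‖y‖⁻¹ + (M ^ 2 - a ^ 2) / 4 * ‖y‖⁻¹ ^ 2) + 1) +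
        a ^ 2 * (y 2 * y 2 * ‖y‖⁻¹ ^ 4) := by
    have h1 := hg₀.mul (hf₀.add (hc 1))
    rw [show (-1 : ℝ) + 0 = -1 by norm_num] at h1
    exact h1.add (hq.mono (by norm_num))
  have hF1 : Tendsto (fun y : E3 ↦
      (1 + (M * ‖y‖⁻¹ + (M ^ 2 - a ^ 2) / 4 * ‖y‖⁻¹ ^ 2)) ^ 2 + a ^ 2 * (y 2 * y 2 * ‖y‖⁻¹ ^ 4))
      (cobounded E3) (𝓝 1) :=
    (hG.tendsto_const_add (by norm_num) (1 : ℝ)).congr fun y ↦ by ring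
  have hC : IsBigOSmooth k (-2) fun y : E3 ↦
      a ^ 2 * (((1 + (M * ‖y‖⁻¹ + (M ^ 2 - a ^ 2) / 4 * ‖y‖⁻¹ ^ 2)) ^ 2 +
          2 * M * ‖y‖⁻¹ * (1 + (M * ‖y‖⁻¹ + (M ^ 2 - a ^ 2) / 4 * ‖y‖⁻¹ ^ 2)) +
          a ^ 2 * (y 2 * y 2 * ‖y‖⁻¹ ^ 4)) *
        ((1 + (M * ‖y‖⁻¹ + (M ^ 2 - a ^ 2) / 4 * ‖y‖⁻¹ ^ 2)) ^ 2 + a ^ 2 * (y 2 * y 2 * ‖y‖⁻¹ ^ 4))⁻¹ *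
        ‖y‖⁻¹ ^ 4) *
      ((v 1 * y 0 - v 0 * y 1) * (w 1 * y 0 - w 0 * y 1)) := by
    have h1 := (((hN.mul (hF.inv hF1)).mul hn4).const_mul (a ^ 2)).mul
      ((((hy 0).const_mul (v 1)).sub ((hy 1).const_mul (v 0))).mul
        (((hy 0).const_mul (w 1)).sub ((hy 1).const_mul (w 0))))
    rw [show (0 : ℝ) + 0 + -4 + (1 + 1) = -2 by norm_num] at h1
    exact h1
  refine ((hA.const_mul ⟪v, w⟫_ℝ).add hC).congr_far (R₁ := σ₅) fun y hy ↦ ?_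
  -- the pointwise identity on the far zone
  have hs0 : 0 < ‖y‖ := hσ₅.trans hy
  have hs : ‖y‖ ≠ 0 := hs0.ne'
  have hr := hfar ‖y‖ hy.le
  have hr0 := hpos ‖y‖ hy.le
  obtain ⟨S, hS⟩ : ∃ S, ϱ ‖y‖ ^ 2 * ‖y‖ ^ 2 + a ^ 2 * y 2 ^ 2 = S := ⟨_, rfl⟩
  have hS0 : S ≠ 0 := by rw [← hS]; positivity
  have eA : (M ^ 2 + 2 * ((M ^ 2 - a ^ 2) / 4)) * ‖y‖⁻¹ ^ 2 + 2 * M * ((M ^ 2 - a ^ 2) / 4) * ‖y‖⁻¹ ^ 3 +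
      ((M ^ 2 - a ^ 2) / 4) ^ 2 * ‖y‖⁻¹ ^ 4 + a ^ 2 * (y 2 * y 2 * ‖y‖⁻¹ ^ 4) =
      S / ‖y‖ ^ 4 - (1 + 2 * M / ‖y‖) := by
    rw [← hS, hr]
    field_simp
    ring
  have eF : (1 + (M * ‖y‖⁻¹ + (M ^ 2 - a ^ 2) / 4 * ‖y‖⁻¹ ^ 2)) ^ 2 + a ^ 2 * (y 2 * y 2 * ‖y‖⁻¹ ^ 4) =
      S * ‖y‖⁻¹ ^ 4 := by
    rw [← hS, hr]
    field_simp
    ring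
  have eC : a ^ 2 * (((1 + (M * ‖y‖⁻¹ + (M ^ 2 - a ^ 2) / 4 * ‖y‖⁻¹ ^ 2)) ^ 2 +
          2 * M * ‖y‖⁻¹ * (1 + (M * ‖y‖⁻¹ + (M ^ 2 - a ^ 2) / 4 * ‖y‖⁻¹ ^ 2)) +
          a ^ 2 * (y 2 * y 2 * ‖y‖⁻¹ ^ 4)) *
        ((1 + (M * ‖y‖⁻¹ + (M ^ 2 - a ^ 2) / 4 * ‖y‖⁻¹ ^ 2)) ^ 2 + a ^ 2 * (y 2 * y 2 * ‖y‖⁻¹ ^ 4))⁻¹ *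
        ‖y‖⁻¹ ^ 4) =
      a ^ 2 * (ϱ ‖y‖ ^ 2 * ‖y‖ ^ 2 + 2 * M * ϱ ‖y‖ * ‖y‖ ^ 2 + a ^ 2 * y 2 ^ 2) / (S * ‖y‖ ^ 4) := by
    rw [eF, hr]
    field_simp
    ring
  rw [hS]
  linear_combination ⟪v, w⟫_ℝ * eA + ((v 1 * y 0 - v 0 * y 1) * (w 1 * y 0 - w 0 * y 1)) * eC

end KerrCap

/-! ### The stub -/

/-- **Registered sub-goal `cap_farMetric` of stub `stub_capFarH`**: the induced metric of the cap map on the far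
zone in closed form, `KerrCap.inducedBilin_capFar`. [cite: BrandtSeidel1996, §II] -/
theorem cap_farMetric : ∀ [Kerr.Facts] {M a c σ₅ rc : ℝ} {τ ϱ α : ℝ → ℝ} {X : E3 → E3} {Ω : Opens E3} {Ψ : Ω → Kerr.region a rc}, |a| < M → 0 < σ₅ → ContDiff ℝ ∞ τ → ContDiff ℝ ∞ ϱ → ContDiff ℝ ∞ α → (∀ s, σ₅ ≤ s → τ s = Negative.bentHeight M a (ϱ s) + c ∧ ϱ s = s + M + (M ^ 2 - a ^ 2) / (4 * s) ∧ α s = a / (Kerr.rPlus M a - Kerr.rMinus M a) * Real.log ((ϱ s - Kerr.rPlus M a) / (ϱ s - Kerr.rMinus M a))) → (∀ s, σ₅ ≤ s → 8 * M < ϱ s) → (∀ u : E3, X u = !₂[(ϱ ‖u‖ * (Real.cos (α ‖u‖) * u 0 - Real.sin (α ‖u‖) * u 1) - a * (Real.sin (α ‖u‖) * u 0 + Real.cos (α ‖u‖) * u 1)) / ‖u‖, (ϱ ‖u‖ * (Real.sin (α ‖u‖) * u 0 + Real.cos (α ‖u‖) * u 1) + a * (Real.cos (α ‖u‖) * u 0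 - Real.sin (α ‖u‖) * u 1)) / ‖u‖, ϱ ‖u‖ * u 2 / ‖u‖]) → (∀ u : Ω, (Ψ u : E4) = E4.ofTimeSpace (τ ‖(u : E3)‖) (X u)) → ∀ (u : Ω), σ₅ < ‖(u : E3)‖ → ∀ (v w : E3), (Kerr.smoothMetric M a rc).inducedBilin 𝓘(ℝ, E3) Ψ u v w = (ϱ ‖(u : E3)‖ ^ 2 * ‖(u : E3)‖ ^ 2 + a ^ 2 * (u : E3) 2 ^ 2) / ‖(u : E3)‖ ^ 4 * ⟪v, w⟫_ℝ + a ^ 2 * (ϱ ‖(u : E3)‖ ^ 2 * ‖(u : E3)‖ ^ 2 + 2 * M * ϱ ‖(u : E3)‖ * ‖(u : E3)‖ ^ 2 + a ^ 2 * (u : E3) 2 ^ 2) / ((ϱ ‖(u : E3)‖ ^ 2 * ‖(u : E3)‖ ^ 2 + a ^ 2 * (u : E3) 2 ^ 2) * ‖(u : E3)‖ ^ 4) * (((u : E3) 0 * v 1 - (u : E3) 1 * v 0) * ((u : E3) 0 * w 1 - (u : E3) 1 * w 0)) :=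
  fun ha hσ₅ hτ hϱ hα hfar h8 hX hΨ u hu v w ↦ KerrCap.inducedBilin_capFar ha hσ₅ hτ hϱ hα hfar h8 hX hΨ u hu v w

/-- **Stub `stub_capFarH` of the line `plug-the-second-sheet` (v4 "KerrCap"), proved verbatim** (asymptotics of the
metric): on the far zone `s > σ₅` the induced metric of the cap map is the Boyer–Lindquist slice metric of
Kerr(`M, a`) in quasi-isotropic Cartesian coordinates,
`h_u(v, w) = (Σ/s²)⟨v, w⟩ + (a²(r² + 2Mr + a²μ²)/(Σ s⁴)) (u₀v₁ − u₁v₀)(u₀w₁ − u₁w₀)`, `r = ϱ(s)`, `μ = u₂/s`,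
`Σ = r² + a²μ²` (`KerrCap.inducedBilin_capFar`: the Kerr–Schild form `η + 2Hℓ ⊗ ℓ` expanded on
`DΦ v = (τ′⟪u,v⟫/s, DX v)` with `τ′ = (2Mr/Δ)ϱ′`, `α′ = (a/Δ)ϱ′`, `Δ = (sϱ′)²`, all spins, axis included), so any
total field `hTot` agreeing with it there has `hTot − (1 + 2M/s) δ ∈ O₂(s⁻²)`: componentwise on the standard basis
(`IsBigOSmooth.of_bilinForm_apply`) it agrees beyond `σ₅` with the symbol of `KerrCap.isBigOSmooth_capFarH`
(`IsBigOSmooth.congr_far`). [cite: BrandtSeidel1996, §II] [cite: Bartnik1986, Def. 2.1] -/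
theorem stub_capFarH :
    ∀ [Kerr.Facts] (M a c σ σ₅ rc : ℝ) (τ ϱ α : ℝ → ℝ) (X : E3 → E3) (Ω : Opens E3)
      (Ψ : Ω → Kerr.region a rc) (hTot : E3 → E3 →L[ℝ] E3 →L[ℝ] ℝ),
      |a| < M → 0 ≤ rc → 0 < σ → σ < σ₅ →
      ContDiff ℝ ∞ τ → ContDiff ℝ ∞ ϱ → ContDiff ℝ ∞ α →
      (∀ s, σ₅ ≤ s → τ s = Negative.bentHeight M a (ϱ s) + c ∧
        ϱ s = s + M + (M ^ 2 - a ^ 2) / (4 * s) ∧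
        α s = a / (Kerr.rPlus M a - Kerr.rMinus M a) *
          Real.log ((ϱ s - Kerr.rPlus M a) / (ϱ s - Kerr.rMinus M a))) →
      (∀ s, σ₅ ≤ s → 8 * M < ϱ s) →
      (∀ u : E3, X u =
        !₂[(ϱ ‖u‖ * (Real.cos (α ‖u‖) * u 0 - Real.sin (α ‖u‖) * u 1) -
              a * (Real.sin (α ‖u‖) * u 0 + Real.cos (α ‖u‖) * u 1)) / ‖u‖,
           (ϱ ‖u‖ * (Real.sin (α ‖u‖) * u 0 + Real.cos (α ‖u‖) * u 1) +
              a * (Real.cos (α ‖u‖) * u 0 - Real.sin (α ‖u‖) * u 1)) / ‖u‖,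
           ϱ ‖u‖ * u 2 / ‖u‖]) →
      (Ω : Set E3) = {u : E3 | σ < ‖u‖} →
      (∀ u : Ω, (Ψ u : E4) = E4.ofTimeSpace (τ ‖(u : E3)‖) (X u)) →
      (∀ (u : Ω), σ₅ < ‖(u : E3)‖ → ∀ v w : E3,
        hTot (u : E3) v w = (Kerr.smoothMetric M a rc).inducedBilin 𝓘(ℝ, E3) Ψ u v w) →
      IsBigOSmooth 2 (-2) fun y : E3 ↦ hTot y - (1 + 2 * M / ‖y‖) • (innerSL ℝ : E3 →L[ℝ] E3 →L[ℝ] ℝ) := by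
  intro inst M a c σ σ₅ rc τ ϱ α X Ω Ψ hTot ha _hrc hσ hσ₅ hτ hϱ hα hfar h8 hX hΩ hΨ hH
  have hM := Negative.mass_pos ha
  have hσ₅0 : 0 < σ₅ := hσ.trans hσ₅
  have hpos : ∀ s, σ₅ ≤ s → 0 < ϱ s := fun s hs ↦ by linarith [h8 s hs]
  refine IsBigOSmooth.of_bilinForm_apply (EuclideanSpace.basisFun (Fin 3) ℝ) fun i j ↦ ?_
  refine (KerrCap.isBigOSmooth_capFarH hσ₅0 (fun s hs ↦ (hfar s hs).2.1) hpos 2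
    (EuclideanSpace.basisFun (Fin 3) ℝ i) (EuclideanSpace.basisFun (Fin 3) ℝ j)).congr_far (R₁ := σ₅)
    fun y hy ↦ ?_
  have hyΩ : y ∈ (Ω : Set E3) := by
    rw [hΩ]
    exact lt_trans hσ₅ hy
  have e : hTot y (EuclideanSpace.basisFun (Fin 3) ℝ i) (EuclideanSpace.basisFun (Fin 3) ℝ j) =
      (Kerr.smoothMetric M a rc).inducedBilin 𝓘(ℝ, E3) Ψ ⟨y, hyΩ⟩ (EuclideanSpace.basisFun (Fin 3) ℝ i)
        (EuclideanSpace.basisFun (Fin 3) ℝ j) :=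
    hH ⟨y, hyΩ⟩ hy _ _
  rw [sub_apply, sub_apply, smul_apply, smul_apply, innerSL_apply_apply, smul_eq_mul, e,
    KerrCap.inducedBilin_capFar ha hσ₅0 hτ hϱ hα hfar h8 hX hΨ ⟨y, hyΩ⟩ hy]

end Summit.FinalStateConjecture.FinalStateConjecture.Theorems.SwallowTheDatum

end
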